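import Mathlib.MeasureTheory.Integral.Prod
import Summits.QuantumFields.BalabanUV.T4Continuum.Support.OutputRateOpGaussian

/-!
# OutputRateOpGaussianParam — the PARAMETRISED complex-Gaussian hook: contour / interpolation parameters under a finite measure
# OUTSIDE the Gaussian integral, a bounded holomorphic prefactor (the Gaussian normalisations), an affine margin uniform in the
# parameter; Fubini done once here ⟹ `TermOpHolomorphicBall` on `PΛ × V`
# (cell `pub-balaban`, T⁴ fan-out, `HOME/BINDER-OWNERS.md` row NE5, owner lineage t4-ne5-p1, gen 29, route P1)

HONEST FRAMING (T4-DAG PAGE 1).  Rung (B)+1 on ONE finite four-torus of fixed physical size — NOT infinite volume, NOT a mass gap, NOT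
the Clay problem; `FlowStep.BetaPertH`, (B), (B^μ) do not occur here.  NE5 (`T4OutputRate.NE5`) is NOT PRINTED and NOT PROVED (spine
0/9, unchanged).  Nothing of Bałaban's series is asserted; 0 cite tags.  The located print (quoted verbatim in the lineage's loci sheet
`b13-loci.md` and the Literature leaf `T4InputCauchyRateData` §11): [II] = [Balaban1988RG2Cluster] p. 15 (2.14) — ONE resummed term is
`Π_Δ ∫₀¹ds(Δ) (2πi)⁻¹∮dσ(Δ)/(σ(Δ) − s(Δ))² · Π_Y ∫₀¹dt(Y) (2πi)⁻¹∮dτ(Y)/(τ(Y) − t(Y))² · ∫dμ₀(X) exp(−½⟨Γ_k(Z₀,σ(Z))X, C^{(k)}(Z₀,σ(Z))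
Γ_k(Z₀,σ(Z))X⟩) ∫dμ_{C^{(k)}(Z₀,σ(Z))}(B) exp(−⟨B, Γ_k X⟩)·(−1)^{|P|}χχ^c·exp[Σ τ(Y)𝐕_k(Y,B)]` — i.e. the CONTOUR and INTERPOLATION
parameters `p = (s, σ, t, τ)` are integrated OUTSIDE the two Gaussian integrals, the covariance and `Γ_k` depend on `σ`, and the Gaussian
normalisations depend on the operators.  HONEST DEPENDENCY (cell, verbatim): continuum YM on T⁴ ⇐ BetaPertH ∧ nine spine estimates (0/9
proved); BetaPertH ⇐ (D1) ∧ (D4) ∧ CAP+tail; G-an2-4 gates asym, D1 and NE2/3/4.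

WHAT THIS MODULE IS.  `OutputRateOpGaussian` (p213354) discharged (H-hol) ∧ (H-meas) ∧ (H-dom) of `OutputRateOpHolomorphic` for terms
that ARE one complex Gaussian integral `∫_V g(v)e^{−q(o,v)}dv` with a margin `Re q(o, v) ≥ m‖v‖²`.  The NE5 formalisation swarm's located
modelling finding (O1-d2-ii, `CLAIMS.log` l.9790: «ONE resummed (2.14)-term is NOT one term datum — it is a CONTOUR INTEGRAL of them»)
asks for the form actually displayed in (2.14): a finite parameter measure `λ` on a parameter space `PΛ` (product of the interpolation
intervals and the Cauchy circles), a bounded Cauchy weight `w(p)`, an operator-dependent bounded HOLOMORPHIC PREFACTOR `N(o, p)` (the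
Gaussian normalisations `det(2πC(o,σ))^{−1/2}`-type factors, bounded on the operator ball by `OutputRateGaussianVolume`), an insertion
`g(p, v)` and a quadratic exponent `q(o, p, v)` holomorphic in `o`, with an AFFINE margin `Re q(o, p, v) ≥ m‖v‖² − b` UNIFORM IN `p`
(the constant `b` absorbs `v`-independent parts of the written exponent).  Here, for that class:
* §1 `norm_mul_cexp_neg_le_shift`, `norm_paramIntegrand_le` — the pointwise majorant `w₀N₀·G₀e^{b}·e^{−(m/2)‖v‖²}`;
  `integrable_paramMajorant`, `integral_paramMajorant` — it is integrable on `PΛ × V` for `λ ⊗ vol` with MASS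
  `λ(PΛ)·w₀N₀G₀e^{b}·(π/(m/2))^{dim V/2}` (Mathlib's `Integrable.mul_prod`, `integral_prod_mul`, `GaussianFourier.integral_rexp_neg_mul_sq_norm`).
* §2 `paramGaussianTerm_clauses` — the four clauses of a dominated holomorphic parametric integral on ANY operator set `𝒪` carrying the
  margin, for the integrand `(p, v) ↦ w(p)N(o,p)g(p,v)e^{−q(o,p,v)}` against `λ ⊗ vol`; `integral_paramIntegrand_prod` — FUBINI: the
  product integral equals the ITERATED integral `∫ w(p)N(o,p) (∫ g(p,v)e^{−q(o,p,v)}dv) dλ(p)` (Mathlib's `integral_prod`, integrability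
  from the majorant) — so an instancer supplies the iterated form it reads off (2.14) and never touches product measures.
* §3 **`differentiableOn_paramGaussianTerm`** — on an OPEN operator domain: the iterated integral is complex differentiable in `o` and
  bounded by the mass (engine `Literature.Analysis.Complex.differentiableOn_integral_of_dominated` BY NAME).
* §4 THE HOOK: hypothesis shape `TermOpGaussianParam T W ctr RHist R′ lam w N gIns q m b w₀ N₀ G₀` (every term, on the open operator ball
  of radius `R′ k` around the class centre, is such an iterated integral with parameter space `β k i`, finite `lam k i h X`, and the side
  conditions uniform on the ball) ⟹ `TermOpHolomorphicBall` with reference measures `(lam k i h X) ⊗ vol` on `β k i × α k i`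
  (**`termOpHolomorphicBall_of_gaussianParam`**) ⟹ `TermOpLineAnalytic` on the ball class (`termOpLineAnalytic_of_gaussianParam`) and,
  with the mass budget, `TermBound` (`termBound_of_gaussianParam`).  `OutputRateOpGaussian.TermOpGaussian` is the sub-case `β = Unit`,
  `w = N = 1`, `b = 0`.
* §5 END face `ne5_at_of_stepModel_termwise_gaussianParam_budget_scale_nat` — the bi-structural budgeted END of `OutputRateOpHolomorphic`
  with its ball-form binder PRODUCED from `TermOpGaussianParam`; every other binder BY NAME; SAME smallness and constant; conclusion
  `T4OutputRate.NE5` LITERALLY (no binder instantiated on Bałaban's objects).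

STATUS (census, Edison rule).  W2-op for (2.14)-shaped terms is thereby reduced to: (H-rep) the DICTIONARY in the displayed form (the
swarm's O1-d2-ii parts /1–/5: parameter spaces, Cauchy weights with `‖w‖ ≤ w₀` on the circles, Gaussian cores, the normalisation prefactor
with its `OutputRateGaussianVolume` bound `N₀`, holomorphy of `q(·, p, v)` and `N(·, p)` on the ball — algebraic), plus the MARGIN uniform in
`p` (base margin `OutputRateOpGaussianMargin.written_exponent_margin` at the decoupled base point + `re_ge_of_baseMargin_lipschitz` on the
ball: the ARITHMETIC side condition `m₁·rOp < m₀`, + the small `τ(Y)·½⟨Q(Y)B,B⟩` part), plus the insertion growth `‖g(p,v)‖ ≤ G₀e^{(m/2)‖v‖²}`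
(bounded characteristic functions × `exp[Σ τ(Y)𝐕_k]` under (1.36)/(1.43)-type budgets).  No wall is discharged from print; S and the
exponent untouched (W2-op is CONSTANT-only); NE5 NOT PROVED; 0/12 leaves on Bałaban's concrete objects; spine 0/9; rung (B)+1 finite T⁴;
NOT infinite volume / mass gap / Clay.  0 sorry; axioms ⊆ {propext, Classical.choice, Quot.sound}.
-/

noncomputable section

open Set Metric MeasureTheory Filter
open scoped RealInnerProductSpace

namespace Summit.QuantumFields.BalabanUV.T4Continuum.OutputRateOpGaussianParam

open Literature.MathematicalPhysics.QuantumFieldTheory.Balaban1983to89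
open Literature.MathematicalPhysics.QuantumFieldTheory.Balaban1983to89.T4OutputRate
open Literature.MathematicalPhysics.QuantumFieldTheory.Balaban1983to89.T4InputCauchyRate
open Literature.MathematicalPhysics.QuantumFieldTheory.Balaban1983to89.T4InputCauchyRateData
open Literature.MathematicalPhysics.QuantumFieldTheory.Balaban1983to89.T4InputCauchyRateSpecies
open Literature.MathematicalPhysics.QuantumFieldTheory.Balaban1983to89.T4InputCauchyRateTermwise
open Summit.QuantumFields.BalabanUV.T4Continuum.OutputRateOpHolomorphic
open Summit.QuantumFields.BalabanUV.T4Continuum.OutputRateOpGaussian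

/-! ## §1 The pointwise majorant of the parametrised integrand; its integrability and mass on `PΛ × V` -/

section Majorant

variable {P : Type*} {V : Type*} [NormedAddCommGroup V] {Op : Type*}

/-- **AFFINE MARGIN ⟹ SHIFTED GAUSSIAN MAJORANT**: if `Re q(v) ≥ m‖v‖² − b` and `‖g v‖ ≤ G₀e^{(m/2)‖v‖²}`, then
`‖g(v)e^{−q(v)}‖ ≤ G₀e^{b}·e^{−(m/2)‖v‖²}` (the constant `b` absorbs the `v`-independent part of a written exponent). [folklore] -/
theorem norm_mul_cexp_neg_le_shift {g : V → ℂ} {G₀ m b : ℝ} {qv : V → ℂ}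
    (hg : ∀ v, ‖g v‖ ≤ G₀ * Real.exp (m / 2 * ‖v‖ ^ 2)) (hq : ∀ v, m * ‖v‖ ^ 2 - b ≤ (qv v).re) (v : V) :
    ‖g v * Complex.exp (-qv v)‖ ≤ G₀ * Real.exp b * Real.exp (-(m / 2) * ‖v‖ ^ 2) := by
  have hG₀ : 0 ≤ G₀ := by
    have h := (norm_nonneg _).trans (hg v)
    exact nonneg_of_mul_nonneg_left (by simpa [mul_comm] using h) (Real.exp_pos _)
  rw [norm_mul, norm_cexp_neg]
  calc ‖g v‖ * Real.exp (-(qv v).re)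
      ≤ G₀ * Real.exp (m / 2 * ‖v‖ ^ 2) * Real.exp (-(m * ‖v‖ ^ 2 - b)) :=
        mul_le_mul (hg v) (Real.exp_le_exp.2 (neg_le_neg (hq v))) (Real.exp_pos _).le
          (mul_nonneg hG₀ (Real.exp_pos _).le)
    _ = G₀ * Real.exp b * Real.exp (-(m / 2) * ‖v‖ ^ 2) := by
        rw [mul_assoc, mul_assoc, ← Real.exp_add, ← Real.exp_add]; ring_nf

/-- **THE POINTWISE MAJORANT OF THE PARAMETRISED INTEGRAND**: with `‖w p‖ ≤ w₀`, `‖N o p‖ ≤ N₀` on the operator set `𝒪`, the margin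
`Re q(o, p, v) ≥ m‖v‖² − b` on `𝒪` uniform in `p`, and insertion growth `‖g p v‖ ≤ G₀e^{(m/2)‖v‖²}`:
`‖w(p)N(o,p)·g(p,v)e^{−q(o,p,v)}‖ ≤ w₀N₀·(G₀e^{b})·e^{−(m/2)‖v‖²}` for `o ∈ 𝒪`. [folklore] -/
theorem norm_paramIntegrand_le {w : P → ℂ} {N : Op → P → ℂ} {g : P → V → ℂ} {q : Op → P → V → ℂ} {𝒪 : Set Op}
    {w₀ N₀ G₀ m b : ℝ} (hw : ∀ p, ‖w p‖ ≤ w₀) (hN : ∀ o ∈ 𝒪, ∀ p, ‖N o p‖ ≤ N₀)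
    (hg : ∀ p v, ‖g p v‖ ≤ G₀ * Real.exp (m / 2 * ‖v‖ ^ 2)) (hq : ∀ o ∈ 𝒪, ∀ p v, m * ‖v‖ ^ 2 - b ≤ (q o p v).re)
    {o : Op} (ho : o ∈ 𝒪) (z : P × V) :
    ‖w z.1 * N o z.1 * (g z.1 z.2 * Complex.exp (-q o z.1 z.2))‖ ≤
      w₀ * N₀ * (G₀ * Real.exp b) * Real.exp (-(m / 2) * ‖z.2‖ ^ 2) := by
  have hw₀ : 0 ≤ w₀ := (norm_nonneg _).trans (hw z.1)
  have h1 : ‖w z.1 * N o z.1‖ ≤ w₀ * N₀ := by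
    rw [norm_mul]; exact mul_le_mul (hw z.1) (hN o ho z.1) (norm_nonneg _) hw₀
  have h2 := norm_mul_cexp_neg_le_shift (hg z.1) (hq o ho z.1) z.2
  rw [norm_mul, mul_assoc (w₀ * N₀)]
  exact mul_le_mul h1 h2 (norm_nonneg _) (mul_nonneg hw₀ ((norm_nonneg _).trans (hN o ho z.1)))

variable [MeasurableSpace P] [InnerProductSpace ℝ V] [FiniteDimensional ℝ V] [MeasurableSpace V] [BorelSpace V]

/-- The majorant `(p, v) ↦ c·e^{−(m/2)‖v‖²}` is integrable on `PΛ × V` for `λ ⊗ vol` when `λ` is finite and `m > 0`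
(Mathlib's `Integrable.mul_prod`). [folklore] -/
theorem integrable_paramMajorant (lam : Measure P) [IsFiniteMeasure lam] {m : ℝ} (hm : 0 < m) (c : ℝ) :
    Integrable (fun z : P × V => c * Real.exp (-(m / 2) * ‖z.2‖ ^ 2)) (lam.prod volume) := by
  have h := (integrable_const c : Integrable (fun _ : P => c) lam).mul_prod
    (integrable_const_mul_exp_neg_mul_sq_norm (V := V) (half_pos hm) 1)
  exact h.congr (Eventually.of_forall fun z => by simp)

/-- Its MASS: `∫ c·e^{−(m/2)‖v‖²} d(λ ⊗ vol) = λ(PΛ)·c·(π/(m/2))^{dim V/2}` (`integral_prod_mul` and the Gaussian mass). [folklore] -/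
theorem integral_paramMajorant (lam : Measure P) [IsFiniteMeasure lam] {m : ℝ} (hm : 0 < m) (c : ℝ) :
    ∫ z : P × V, c * Real.exp (-(m / 2) * ‖z.2‖ ^ 2) ∂(lam.prod volume) =
      lam.real univ * c * (Real.pi / (m / 2)) ^ (Module.finrank ℝ V / 2 : ℝ) := by
  have h := integral_prod_mul (μ := lam) (ν := (volume : Measure V)) (fun _ : P => c)
    (fun v : V => Real.exp (-(m / 2) * ‖v‖ ^ 2))
  rw [h, integral_const, GaussianFourier.integral_rexp_neg_mul_sq_norm (half_pos hm), smul_eq_mul, mul_assoc]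

end Majorant

/-! ## §2 The four clauses on any operator set with the margin, and Fubini (product = iterated) -/

section Clauses

variable {P : Type*} [MeasurableSpace P] {V : Type*} [NormedAddCommGroup V] [InnerProductSpace ℝ V] [FiniteDimensional ℝ V]
  [MeasurableSpace V] [BorelSpace V] {Op : Type*} [NormedAddCommGroup Op] [NormedSpace ℂ Op]

/-- **THE FOUR CLAUSES FOR THE PARAMETRISED GAUSSIAN INTEGRAND** `(p, v) ↦ w(p)N(o,p)·g(p,v)e^{−q(o,p,v)}` against `λ ⊗ vol` on an
operator set `𝒪`: given `λ` finite, `m > 0`, `w` a.e.-strongly measurable with `‖w‖ ≤ w₀`, `N(o, ·)` a.e.-strongly measurable and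
`‖N(o, ·)‖ ≤ N₀` for `o ∈ 𝒪` with `N(·, p)` holomorphic on `𝒪`, `g` jointly a.e.-strongly measurable with growth `≤ G₀e^{(m/2)‖v‖²}`,
`q(o, ·, ·)` jointly a.e.-strongly measurable for `o ∈ 𝒪`, `q(·, p, v)` holomorphic on `𝒪`, and the margin `Re q ≥ m‖v‖² − b` on `𝒪`:
the integrand is a.e.-strongly measurable for `o ∈ 𝒪`, holomorphic in `o` on `𝒪` for every `(p, v)`, and dominated on ALL of `𝒪` by
the integrable `w₀N₀G₀e^{b}·e^{−(m/2)‖v‖²}`. [folklore] -/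
theorem paramGaussianTerm_clauses {lam : Measure P} [IsFiniteMeasure lam] {w : P → ℂ} {N : Op → P → ℂ} {g : P → V → ℂ}
    {q : Op → P → V → ℂ} {𝒪 : Set Op} {w₀ N₀ G₀ m b : ℝ} (hm : 0 < m)
    (hw_meas : AEStronglyMeasurable w lam) (hw : ∀ p, ‖w p‖ ≤ w₀)
    (hN_meas : ∀ o ∈ 𝒪, AEStronglyMeasurable (N o) lam) (hN_hol : ∀ p, DifferentiableOn ℂ (fun o => N o p) 𝒪)
    (hN : ∀ o ∈ 𝒪, ∀ p, ‖N o p‖ ≤ N₀)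
    (hg_meas : AEStronglyMeasurable (Function.uncurry g) (lam.prod volume))
    (hg : ∀ p v, ‖g p v‖ ≤ G₀ * Real.exp (m / 2 * ‖v‖ ^ 2))
    (hq_meas : ∀ o ∈ 𝒪, AEStronglyMeasurable (Function.uncurry (q o)) (lam.prod volume))
    (hq_hol : ∀ p v, DifferentiableOn ℂ (fun o => q o p v) 𝒪)
    (hq_re : ∀ o ∈ 𝒪, ∀ p v, m * ‖v‖ ^ 2 - b ≤ (q o p v).re) :
    (∀ o ∈ 𝒪, AEStronglyMeasurable (fun z : P × V => w z.1 * N o z.1 * (g z.1 z.2 * Complex.exp (-q o z.1 z.2)))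
        (lam.prod volume)) ∧
    (∀ᵐ z ∂(lam.prod (volume : Measure V)),
        DifferentiableOn ℂ (fun o => w z.1 * N o z.1 * (g z.1 z.2 * Complex.exp (-q o z.1 z.2))) 𝒪) ∧
    Integrable (fun z : P × V => w₀ * N₀ * (G₀ * Real.exp b) * Real.exp (-(m / 2) * ‖z.2‖ ^ 2)) (lam.prod volume) ∧
    (∀ᵐ z ∂(lam.prod (volume : Measure V)), ∀ o ∈ 𝒪,
        ‖w z.1 * N o z.1 * (g z.1 z.2 * Complex.exp (-q o z.1 z.2))‖ ≤
          w₀ * N₀ * (G₀ * Real.exp b) * Real.exp (-(m / 2) * ‖z.2‖ ^ 2)) := by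
  refine ⟨fun o ho => ?_, Eventually.of_forall fun z => ?_, integrable_paramMajorant lam hm _,
    Eventually.of_forall fun z o ho => norm_paramIntegrand_le hw hN hg hq_re ho z⟩
  · have hw' : AEStronglyMeasurable (fun z : P × V => w z.1) (lam.prod volume) :=
      (hw_meas.aemeasurable.comp_fst (ν := (volume : Measure V))).aestronglyMeasurable
    have hN' : AEStronglyMeasurable (fun z : P × V => N o z.1) (lam.prod volume) :=
      ((hN_meas o ho).aemeasurable.comp_fst (ν := (volume : Measure V))).aestronglyMeasurable
    exact (hw'.mul hN').mul (hg_meas.mul (Complex.continuous_exp.comp_aestronglyMeasurable (hq_meas o ho).neg))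
  · exact ((hN_hol z.1).const_mul (w z.1)).mul (((hq_hol z.1 z.2).neg.cexp).const_mul (g z.1 z.2))

/-- The parametrised integrand is INTEGRABLE on `PΛ × V` for `o ∈ 𝒪` (dominated by the integrable majorant). [folklore] -/
theorem integrable_paramIntegrand {lam : Measure P} [IsFiniteMeasure lam] {w : P → ℂ} {N : Op → P → ℂ} {g : P → V → ℂ}
    {q : Op → P → V → ℂ} {𝒪 : Set Op} {w₀ N₀ G₀ m b : ℝ} (hm : 0 < m)
    (hw_meas : AEStronglyMeasurable w lam) (hw : ∀ p, ‖w p‖ ≤ w₀)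
    (hN_meas : ∀ o ∈ 𝒪, AEStronglyMeasurable (N o) lam) (hN_hol : ∀ p, DifferentiableOn ℂ (fun o => N o p) 𝒪)
    (hN : ∀ o ∈ 𝒪, ∀ p, ‖N o p‖ ≤ N₀)
    (hg_meas : AEStronglyMeasurable (Function.uncurry g) (lam.prod volume))
    (hg : ∀ p v, ‖g p v‖ ≤ G₀ * Real.exp (m / 2 * ‖v‖ ^ 2))
    (hq_meas : ∀ o ∈ 𝒪, AEStronglyMeasurable (Function.uncurry (q o)) (lam.prod volume))
    (hq_hol : ∀ p v, DifferentiableOn ℂ (fun o => q o p v) 𝒪)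
    (hq_re : ∀ o ∈ 𝒪, ∀ p v, m * ‖v‖ ^ 2 - b ≤ (q o p v).re) {o : Op} (ho : o ∈ 𝒪) :
    Integrable (fun z : P × V => w z.1 * N o z.1 * (g z.1 z.2 * Complex.exp (-q o z.1 z.2))) (lam.prod volume) := by
  obtain ⟨hmeas, -, hint, hdom⟩ := paramGaussianTerm_clauses hm hw_meas hw hN_meas hN_hol hN hg_meas hg hq_meas hq_hol hq_re
  exact hint.mono' (hmeas o ho) (by filter_upwards [hdom] with z hz using hz o ho)

/-- **FUBINI FOR THE PARAMETRISED TERM**: for `o ∈ 𝒪` the product integral over `PΛ × V` equals the ITERATED integral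
`∫ w(p)N(o,p)·(∫ g(p,v)e^{−q(o,p,v)} dv) dλ(p)` — the form an instancer reads off (2.14) (Mathlib's `integral_prod`; integrability from
the majorant; the `v`-independent factor pulled out of the inner integral). [folklore] -/
theorem integral_paramIntegrand_prod {lam : Measure P} [IsFiniteMeasure lam] {w : P → ℂ} {N : Op → P → ℂ} {g : P → V → ℂ}
    {q : Op → P → V → ℂ} {𝒪 : Set Op} {w₀ N₀ G₀ m b : ℝ} (hm : 0 < m)
    (hw_meas : AEStronglyMeasurable w lam) (hw : ∀ p, ‖w p‖ ≤ w₀)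
    (hN_meas : ∀ o ∈ 𝒪, AEStronglyMeasurable (N o) lam) (hN_hol : ∀ p, DifferentiableOn ℂ (fun o => N o p) 𝒪)
    (hN : ∀ o ∈ 𝒪, ∀ p, ‖N o p‖ ≤ N₀)
    (hg_meas : AEStronglyMeasurable (Function.uncurry g) (lam.prod volume))
    (hg : ∀ p v, ‖g p v‖ ≤ G₀ * Real.exp (m / 2 * ‖v‖ ^ 2))
    (hq_meas : ∀ o ∈ 𝒪, AEStronglyMeasurable (Function.uncurry (q o)) (lam.prod volume))
    (hq_hol : ∀ p v, DifferentiableOn ℂ (fun o => q o p v) 𝒪)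
    (hq_re : ∀ o ∈ 𝒪, ∀ p v, m * ‖v‖ ^ 2 - b ≤ (q o p v).re) {o : Op} (ho : o ∈ 𝒪) :
    ∫ z : P × V, w z.1 * N o z.1 * (g z.1 z.2 * Complex.exp (-q o z.1 z.2)) ∂(lam.prod volume) =
      ∫ p, w p * N o p * ∫ v, g p v * Complex.exp (-q o p v) ∂(volume : Measure V) ∂lam := by
  rw [integral_prod _ (integrable_paramIntegrand hm hw_meas hw hN_meas hN_hol hN hg_meas hg hq_meas hq_hol hq_re ho)]
  refine integral_congr_ae (Eventually.of_forall fun p => ?_)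
  simp only
  exact integral_const_mul _ _

end Clauses

/-! ## §3 The parametrised Gaussian term is holomorphic in the operator datum on any open domain with the margin -/

section Holomorphic

variable {P : Type*} [MeasurableSpace P] {V : Type*} [NormedAddCommGroup V] [InnerProductSpace ℝ V] [FiniteDimensional ℝ V]
  [MeasurableSpace V] [BorelSpace V] {Op : Type*} [NormedAddCommGroup Op] [NormedSpace ℂ Op]

/-- **PARAMETRISED COMPLEX GAUSSIAN TERMS ARE HOLOMORPHIC IN THE OPERATOR DATUM, WITH THE MASS BOUND** — (H-hol) ∧ (H-meas) ∧ (H-dom)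
of `OutputRateOpHolomorphic` from the margin alone, in the displayed form of (2.14): on an OPEN operator domain `𝒪` as in
`paramGaussianTerm_clauses`, the ITERATED integral `o ↦ ∫ w(p)N(o,p)(∫ g(p,v)e^{−q(o,p,v)}dv) dλ(p)` is complex differentiable on `𝒪`
(engine `Literature.Analysis.Complex.differentiableOn_integral_of_dominated` on `PΛ × V`, then Fubini) and bounded there by the mass
`λ(PΛ)·w₀N₀G₀e^{b}·(π/(m/2))^{dim V/2}`. [folklore] -/
theorem differentiableOn_paramGaussianTerm {lam : Measure P} [IsFiniteMeasure lam] {w : P → ℂ} {N : Op → P → ℂ}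
    {g : P → V → ℂ} {q : Op → P → V → ℂ} {𝒪 : Set Op} {w₀ N₀ G₀ m b : ℝ} (h𝒪 : IsOpen 𝒪) (hm : 0 < m)
    (hw_meas : AEStronglyMeasurable w lam) (hw : ∀ p, ‖w p‖ ≤ w₀)
    (hN_meas : ∀ o ∈ 𝒪, AEStronglyMeasurable (N o) lam) (hN_hol : ∀ p, DifferentiableOn ℂ (fun o => N o p) 𝒪)
    (hN : ∀ o ∈ 𝒪, ∀ p, ‖N o p‖ ≤ N₀)
    (hg_meas : AEStronglyMeasurable (Function.uncurry g) (lam.prod volume))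
    (hg : ∀ p v, ‖g p v‖ ≤ G₀ * Real.exp (m / 2 * ‖v‖ ^ 2))
    (hq_meas : ∀ o ∈ 𝒪, AEStronglyMeasurable (Function.uncurry (q o)) (lam.prod volume))
    (hq_hol : ∀ p v, DifferentiableOn ℂ (fun o => q o p v) 𝒪)
    (hq_re : ∀ o ∈ 𝒪, ∀ p v, m * ‖v‖ ^ 2 - b ≤ (q o p v).re) :
    DifferentiableOn ℂ (fun o => ∫ p, w p * N o p * ∫ v, g p v * Complex.exp (-q o p v) ∂(volume : Measure V) ∂lam) 𝒪 ∧
      ∀ o ∈ 𝒪, ‖∫ p, w p * N o p * ∫ v, g p v * Complex.exp (-q o p v) ∂(volume : Measure V) ∂lam‖ ≤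
        lam.real univ * (w₀ * N₀ * (G₀ * Real.exp b)) * (Real.pi / (m / 2)) ^ (Module.finrank ℝ V / 2 : ℝ) := by
  obtain ⟨hmeas, hdiff, hint, hdom⟩ :=
    paramGaussianTerm_clauses hm hw_meas hw hN_meas hN_hol hN hg_meas hg hq_meas hq_hol hq_re
  have hfub : ∀ o ∈ 𝒪, ∫ z : P × V, w z.1 * N o z.1 * (g z.1 z.2 * Complex.exp (-q o z.1 z.2)) ∂(lam.prod volume) =
      ∫ p, w p * N o p * ∫ v, g p v * Complex.exp (-q o p v) ∂(volume : Measure V) ∂lam := fun o ho =>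
    integral_paramIntegrand_prod hm hw_meas hw hN_meas hN_hol hN hg_meas hg hq_meas hq_hol hq_re ho
  refine ⟨(Literature.Analysis.Complex.differentiableOn_integral_of_dominated hmeas hdiff fun o₀ ho₀ => ?_).congr
    fun o ho => (hfub o ho).symm, fun o ho => ?_⟩
  · obtain ⟨R, hR, hsub⟩ := Metric.isOpen_iff.1 h𝒪 o₀ ho₀
    exact ⟨R, hR, hsub, _, hint, by filter_upwards [hdom] with z hz o ho using hz o (hsub ho)⟩
  · rw [← hfub o ho, ← integral_paramMajorant lam hm (w₀ * N₀ * (G₀ * Real.exp b))]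
    exact norm_integral_le_of_majorant hint (by filter_upwards [hdom] with z hz using hz o ho)

end Holomorphic

/-! ## §4 The hook: parametrised complex Gaussian term families ⟹ `TermOpHolomorphicBall` ⟹ `TermOpLineAnalytic` / `TermBound` -/

section Hook

variable {C : Carriers} {Op Hist : Type*} [NormedAddCommGroup Op] [NormedSpace ℂ Op] [NormedAddCommGroup Hist]
  [NormedSpace ℂ Hist] {ι : Type*} (T : ℕ → ι → Op → Hist → C.Dom → ℂ)
  {β : ℕ → ι → Type*} [∀ k i, MeasurableSpace (β k i)]
  {α : ℕ → ι → Type*} [∀ k i, NormedAddCommGroup (α k i)] [∀ k i, InnerProductSpace ℝ (α k i)]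
  [∀ k i, FiniteDimensional ℝ (α k i)] [∀ k i, MeasurableSpace (α k i)] [∀ k i, BorelSpace (α k i)]

/-- HYPOTHESIS SHAPE `TermOpGaussianParam T W ctr RHist R′ lam w N gIns q m b w₀ N₀ G₀` ([analysis]; our dictionary for ONE resummed
term of (2.14) in its DISPLAYED form, asserted nowhere): for every history datum of the class's history ball, step-`k` domain `X` and
term index `i`, with parameter space `β k i` (contour and interpolation parameters) carrying the FINITE measure `lam k i h X`, Cauchy
weight `w k i h X : β k i → ℂ`, normalisation prefactor `N k i h X : Op → β k i → ℂ`, insertion `gIns k i h X : β k i → α k i → ℂ` on the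
finite-dimensional fluctuation-field space `α k i` and exponent `q k i h X : Op → β k i → α k i → ℂ`: margin constant `m > 0`;
`w` a.e.-strongly measurable with `‖w p‖ ≤ w₀`; on the open operator ball of radius `R′ k` around the class centre, `N(o, ·)`
a.e.-strongly measurable with `‖N(o, p)‖ ≤ N₀` and `N(·, p)` holomorphic; `gIns` jointly a.e.-strongly measurable with growth
`‖gIns p v‖ ≤ G₀e^{(m/2)‖v‖²}`; `q(o, ·, ·)` jointly a.e.-strongly measurable, `q(·, p, v)` holomorphic on the ball, AFFINE MARGIN
`Re q(o, p, v) ≥ m‖v‖² − b` on the ball uniform in `p`; and the term IS the iterated integral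
`T k i o h X = ∫ w(p)N(o,p)(∫ gIns(p,v)e^{−q(o,p,v)}dv) dλ(p)` for `o` in the ball. [folklore] -/
def TermOpGaussianParam (W : Set (ℕ → ℝ)) (ctr : ℕ → (ℕ → ℝ) → C.BgB → Op × Hist) (RHist R' : ℕ → ℝ)
    (lam : ∀ k i, Hist → C.Dom → Measure (β k i)) (w : ∀ k i, Hist → C.Dom → β k i → ℂ)
    (N : ∀ k i, Hist → C.Dom → Op → β k i → ℂ) (gIns : ∀ k i, Hist → C.Dom → β k i → α k i → ℂ)
    (q : ∀ k i, Hist → C.Dom → Op → β k i → α k i → ℂ) (m b w₀ N₀ G₀ : ℕ → ι → Hist → C.Dom → ℝ) : Prop :=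
  ∀ k, ∀ g ∈ W, ∀ (U : C.BgB), ∀ h ∈ closedBall (ctr k g U).2 (RHist k), ∀ X : C.Dom, C.scale X = k → ∀ i,
    IsFiniteMeasure (lam k i h X) ∧ 0 < m k i h X ∧
    AEStronglyMeasurable (w k i h X) (lam k i h X) ∧ (∀ p, ‖w k i h X p‖ ≤ w₀ k i h X) ∧
    (∀ o ∈ ball (ctr k g U).1 (R' k), AEStronglyMeasurable (N k i h X o) (lam k i h X)) ∧
    (∀ p, DifferentiableOn ℂ (fun o => N k i h X o p) (ball (ctr k g U).1 (R' k))) ∧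
    (∀ o ∈ ball (ctr k g U).1 (R' k), ∀ p, ‖N k i h X o p‖ ≤ N₀ k i h X) ∧
    AEStronglyMeasurable (Function.uncurry (gIns k i h X)) ((lam k i h X).prod volume) ∧
    (∀ p v, ‖gIns k i h X p v‖ ≤ G₀ k i h X * Real.exp (m k i h X / 2 * ‖v‖ ^ 2)) ∧
    (∀ o ∈ ball (ctr k g U).1 (R' k), AEStronglyMeasurable (Function.uncurry (q k i h X o)) ((lam k i h X).prod volume)) ∧
    (∀ p v, DifferentiableOn ℂ (fun o => q k i h X o p v) (ball (ctr k g U).1 (R' k))) ∧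
    (∀ o ∈ ball (ctr k g U).1 (R' k), ∀ p v, m k i h X * ‖v‖ ^ 2 - b k i h X ≤ (q k i h X o p v).re) ∧
    (∀ o ∈ ball (ctr k g U).1 (R' k), T k i o h X =
      ∫ p, w k i h X p * N k i h X o p * ∫ v, gIns k i h X p v * Complex.exp (-q k i h X o p v) ∂volume ∂(lam k i h X))

variable {T}

variable (α) in
/-- the mass of the one majorant of term `i` at `(k, h, X)`: `λ(β)·w₀N₀G₀e^{b}·(π/(m/2))^{dim(α k i)/2}`. [folklore] -/
def paramMass (lam : ∀ k i, Hist → C.Dom → Measure (β k i)) (m b w₀ N₀ G₀ : ℕ → ι → Hist → C.Dom → ℝ) (k : ℕ) (i : ι)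
    (h : Hist) (X : C.Dom) : ℝ :=
  (lam k i h X).real univ * (w₀ k i h X * N₀ k i h X * (G₀ k i h X * Real.exp (b k i h X))) *
    (Real.pi / (m k i h X / 2)) ^ (Module.finrank ℝ (α k i) / 2 : ℝ)

omit [NormedSpace ℂ Hist] in
/-- **PARAMETRISED COMPLEX GAUSSIAN TERM FAMILIES SATISFY THE BALL FORM** of `OutputRateOpHolomorphic` with the reference measures
`(lam k i h X) ⊗ vol` on `β k i × α k i`, the integrands `(p, v) ↦ w(p)N(o,p)·gIns(p,v)e^{−q(o,p,v)}` and the majorants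
`w₀N₀G₀e^{b}·e^{−(m/2)‖v‖²}` — §2 at each `(k, h, X, i)`, the representation clause by Fubini (`integral_paramIntegrand_prod`). [folklore] -/
theorem termOpHolomorphicBall_of_gaussianParam {W : Set (ℕ → ℝ)} {ctr : ℕ → (ℕ → ℝ) → C.BgB → Op × Hist} {RHist R' : ℕ → ℝ}
    {lam : ∀ k i, Hist → C.Dom → Measure (β k i)} {w : ∀ k i, Hist → C.Dom → β k i → ℂ}
    {N : ∀ k i, Hist → C.Dom → Op → β k i → ℂ} {gIns : ∀ k i, Hist → C.Dom → β k i → α k i → ℂ}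
    {q : ∀ k i, Hist → C.Dom → Op → β k i → α k i → ℂ} {m b w₀ N₀ G₀ : ℕ → ι → Hist → C.Dom → ℝ}
    (hG : TermOpGaussianParam T W ctr RHist R' lam w N gIns q m b w₀ N₀ G₀) :
    TermOpHolomorphicBall T W ctr RHist R' (fun k i h X => (lam k i h X).prod (volume : Measure (α k i)))
      fun k i h X o z => w k i h X z.1 * N k i h X o z.1 * (gIns k i h X z.1 z.2 * Complex.exp (-q k i h X o z.1 z.2)) := by
  intro k g hg U h hh X hX i
  obtain ⟨hfin, hm, hwm, hwb, hNm, hNh, hNb, hgm, hgb, hqm, hqh, hqre, hrepr⟩ := hG k g hg U h hh X hX i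
  haveI := hfin
  obtain ⟨hmeas, hdiff, hint, hdom⟩ := paramGaussianTerm_clauses hm hwm hwb hNm hNh hNb hgm hgb hqm hqh hqre
  refine ⟨hmeas, hdiff, ⟨_, hint, hdom⟩, fun o ho => ?_⟩
  rw [hrepr o ho, integral_paramIntegrand_prod hm hwm hwb hNm hNh hNb hgm hgb hqm hqh hqre ho]

omit [NormedSpace ℂ Hist] in
/-- Hence `TermOpLineAnalytic` on the ball class for parametrised complex Gaussian term families (room `ROp k < R′ k`) — NO analyticity
hypothesis on the operator species left, only the margin uniform in the parameter. [folklore] -/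
theorem termOpLineAnalytic_of_gaussianParam {W : Set (ℕ → ℝ)} {ctr : ℕ → (ℕ → ℝ) → C.BgB → Op × Hist} {ROp RHist R' : ℕ → ℝ}
    {lam : ∀ k i, Hist → C.Dom → Measure (β k i)} {w : ∀ k i, Hist → C.Dom → β k i → ℂ}
    {N : ∀ k i, Hist → C.Dom → Op → β k i → ℂ} {gIns : ∀ k i, Hist → C.Dom → β k i → α k i → ℂ}
    {q : ∀ k i, Hist → C.Dom → Op → β k i → α k i → ℂ} {m b w₀ N₀ G₀ : ℕ → ι → Hist → C.Dom → ℝ}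
    (hroom : ∀ k, ROp k < R' k) (hG : TermOpGaussianParam T W ctr RHist R' lam w N gIns q m b w₀ N₀ G₀) :
    TermOpLineAnalytic (ballClass ctr ROp RHist) T W :=
  termOpLineAnalytic_of_ball hroom (termOpHolomorphicBall_of_gaussianParam hG)

omit [NormedSpace ℂ Hist] in
/-- And `TermBound` on the ball class from the MASS budget `paramMass α lam m b w₀ N₀ G₀ k i h X ≤ a k i·e^{−κd(X)}`
(`termBound_of_ball_majorant` with the one majorant; its mass by `integral_paramMajorant`). [folklore] -/
theorem termBound_of_gaussianParam {W : Set (ℕ → ℝ)} {ctr : ℕ → (ℕ → ℝ) → C.BgB → Op × Hist} {ROp RHist R' : ℕ → ℝ}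
    {lam : ∀ k i, Hist → C.Dom → Measure (β k i)} {w : ∀ k i, Hist → C.Dom → β k i → ℂ}
    {N : ∀ k i, Hist → C.Dom → Op → β k i → ℂ} {gIns : ∀ k i, Hist → C.Dom → β k i → α k i → ℂ}
    {q : ∀ k i, Hist → C.Dom → Op → β k i → α k i → ℂ} {m b w₀ N₀ G₀ : ℕ → ι → Hist → C.Dom → ℝ}
    (hroom : ∀ k, ROp k < R' k) (hG : TermOpGaussianParam T W ctr RHist R' lam w N gIns q m b w₀ N₀ G₀) {κ : ℝ}
    {a : ℕ → ι → ℝ}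
    (hbudget : ∀ k, ∀ g ∈ W, ∀ (U : C.BgB), ∀ h ∈ closedBall (ctr k g U).2 (RHist k), ∀ X : C.Dom, C.scale X = k → ∀ i,
      paramMass α lam m b w₀ N₀ G₀ k i h X ≤ a k i * Real.exp (-(κ * C.d X))) :
    TermBound (ballClass ctr ROp RHist) T W κ a := by
  refine termBound_of_ball_majorant hroom (termOpHolomorphicBall_of_gaussianParam hG) fun k g hg U h hh X hX i => ?_
  obtain ⟨hfin, hm, hwm, hwb, hNm, hNh, hNb, hgm, hgb, hqm, hqh, hqre, -⟩ := hG k g hg U h hh X hX i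
  haveI := hfin
  obtain ⟨-, -, hint, hdom⟩ := paramGaussianTerm_clauses hm hwm hwb hNm hNh hNb hgm hgb hqm hqh hqre
  refine ⟨_, hint, hdom, ?_⟩
  rw [integral_paramMajorant (lam k i h X) hm]
  exact hbudget k g hg U h hh X hX i

end Hook

/-! ## §5 END face: NE5 from budgeted termwise data with the operator species a PARAMETRISED GAUSSIAN family -/

section End

variable {C : Carriers} {Op Hist : Type*} [NormedAddCommGroup Op] [NormedSpace ℂ Op] [NormedAddCommGroup Hist]
  [NormedSpace ℂ Hist] {ι : Type*} (M : StepModel C Op Hist) (T : ℕ → ι → Op → Hist → C.Dom → ℂ)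
  {β : ℕ → ι → Type*} [∀ k i, MeasurableSpace (β k i)]
  {αO : ℕ → ι → Type*} [∀ k i, NormedAddCommGroup (αO k i)] [∀ k i, InnerProductSpace ℝ (αO k i)]
  [∀ k i, FiniteDimensional ℝ (αO k i)] [∀ k i, MeasurableSpace (αO k i)] [∀ k i, BorelSpace (αO k i)]

/-- **NE5 FROM BUDGET, TERMWISE DATA, THE OPERATOR SPECIES A PARAMETRISED GAUSSIAN FAMILY AND THE HISTORY SPECIES EXP-LINEAR** —
`OutputRateOpHolomorphic.ne5_at_of_stepModel_termwise_biStructural_budget_scale_nat` with its ball-form binder `hball` PRODUCED by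
§4 from `TermOpGaussianParam` (room `ROp k < R′ k`); every other binder BY NAME and unchanged (MI-R, budget, `TermRep`/`TermBound`/
`TermBudget`, `TermHistExpLinear`, one-run levels, W1, W4, insertion structure, W3, R, S); SAME smallness `ω + G·c/(1 − ρ₀) < θ′`,
SAME constant; conclusion `T4OutputRate.NE5` LITERALLY.  NOT a proof of NE5 for Bałaban's step: no binder is instantiated on his
objects here (the dictionary `TermOpGaussianParam` for the model of record is the swarm's O1-d2-ii). [folklore] -/
theorem ne5_at_of_stepModel_termwise_gaussianParam_budget_scale_nat {EA : Functional C C.BgA} {EB : Functional C C.BgB}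
    {W : Set (ℕ → ℝ)} {ctr : ℕ → (ℕ → ℝ) → C.BgB → Op × Hist} {BOp BHist ROp RHist R' : ℕ → ℝ} {a : ℕ → ι → ℝ}
    {lam : ∀ k i, Hist → C.Dom → Measure (β k i)} {w : ∀ k i, Hist → C.Dom → β k i → ℂ}
    {N : ∀ k i, Hist → C.Dom → Op → β k i → ℂ} {gIns : ∀ k i, Hist → C.Dom → β k i → αO k i → ℂ}
    {q : ∀ k i, Hist → C.Dom → Op → β k i → αO k i → ℂ} {m b w₀ N₀ G₀ : ℕ → ι → Hist → C.Dom → ℝ}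
    {α : ℕ → ι → Type*} [∀ k i, MeasurableSpace (α k i)]
    {μ : ∀ k i, Op → C.Dom → Measure (α k i)} {Φ : ∀ k i, Op → C.Dom → α k i → ℂ}
    {Λ : ∀ k i, Op → C.Dom → α k i → (Hist →L[ℂ] ℂ)} {κ G EA₀ E₀ E₁ δ δ' θ θ' c ω ρ₀ B : ℝ} {k₀ : ℕ}
    (hrA : M.RepresentsA EA W) (hrB : M.RepresentsB EB W) (hbase : M.InBase EB W) (hbudget : BaseBudget M W ctr BOp BHist)
    (hOp : ∀ k, BOp k + M.rOp k ≤ ROp k) (hHist : ∀ k, BHist k + M.rHist k ≤ RHist k)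
    (hrep : TermRep M (ballClass ctr ROp RHist) T W) (hbd : TermBound (ballClass ctr ROp RHist) T W κ a)
    (hbud : TermBudget a G) (hroom : ∀ k, ROp k < R' k)
    (hG : TermOpGaussianParam T W ctr RHist R' lam w N gIns q m b w₀ N₀ G₀)
    (hexp : TermHistExpLinear (ballClass ctr ROp RHist) T W μ Φ Λ) (hdA : DecayBound EA W EA₀ κ)
    (hdB : DecayBound EB W E₀ κ) (hop : M.OperatorRate W δ θ) (hins : M.InsertionRate W κ E₀ δ' θ)
    (haff : M.InsAffine W) (hblind : M.InsBlind W) (hhom : M.InsHomog W) (hunit : M.InsScaleBound W κ E₁ c ω)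
    (hE₁ : 0 < E₁) (hG0 : 0 ≤ G) (hδ : 0 ≤ δ) (hδ' : 0 ≤ δ') (hθ : 0 ≤ θ) (hθθ' : θ ≤ θ') (hθ'1 : θ' ≤ 1) (hc : 0 ≤ c)
    (hω : 0 < ω) (hρ₀ : ρ₀ < 1) (hnear : (δ + δ') * θ ^ k₀ + c * (EA₀ + E₀) / (1 - ω) ≤ ρ₀) (hB : 0 ≤ B)
    (hfirst : ∀ k < k₀, EA₀ + E₀ ≤ B * θ ^ k) (hsmall : ω + G / (1 - ρ₀) * c < θ') :
    NE5 EA EB W κ θ' ((G / (1 - ρ₀) * δ + G / (1 - ρ₀) * δ' + B) * (θ' - ω) / (θ' - (ω + G / (1 - ρ₀) * c))) :=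
  ne5_at_of_stepModel_termwise_biStructural_budget_scale_nat M T hrA hrB hbase hbudget hOp hHist hrep hbd hbud hroom
    (termOpHolomorphicBall_of_gaussianParam hG) hexp hdA hdB hop hins haff hblind hhom hunit hE₁ hG0 hδ hδ' hθ hθθ' hθ'1 hc
    hω hρ₀ hnear hB hfirst hsmall

end End

end Summit.QuantumFields.BalabanUV.T4Continuum.OutputRateOpGaussianParam

end
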